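/-
Copyright: statement-level skeleton of a published paper (lit-balaban cell, Phase-2 proof seat p39 gen 8). No proof claims
beyond what the kernel checks below.
-/
import Literature.MathematicalPhysics.QuantumFieldTheory.Balaban1983to89.B3CxiTorusBound

/-!
# B3 — T. Bałaban, *(Higgs)₂,₃ quantum fields in a finite volume. III. Renormalization*, CMP **88** (1983) 411–445
[Balaban1983Higgs3], pp. 440–442: UNFOLDING THE TORUS — the free propagator `C^ξ_T` of the periodic ξ-lattice (p03's
`B3CxiTorusBound.CxiT`, the periodization `Σ_{n∈ℤ^d} C^ξ(ỹ − ỹ′ + N·n)` of the ξℤ^d propagator `C^ξ`) and its difference kernels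
`(C^ξ_T∂^{ξ*}_μ)`, `(∂^ξ_{μ′}C^ξ_T∂^{ξ*}_μ)` of (3.26) ARE the periodizations of the corresponding ξℤ^d kernels, and a torus `x′`-sum of
a product of two such kernels UNFOLDS into `Σ_{k∈ℤ^d}Σ_{w∈ℤ^d} f(w)·g(N·k − w)·ρ`: the `k = 0` term is the infinite-lattice
expression of pp. 441–442 ((3.27), (3.29)), the `k ≠ 0` terms are the wrap-around corrections of the finite volume

statement-level skeleton of published theorems with citation tags; proofs where landed; nothing here is a claim about
the Yang–Mills mass gap

PDF held: `paper:balaban1983-higgs-2-3-quantum-fields-finite-volume` (journal page = PDF page + 410); pp. 440–442 [PDF 30–32] read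
on the ×2 renders `run/shared/lean/pub/pub-balaban/b2b-balaban-ref1/pages/1983-cmp88-higgs23-III/1983-cmp88-higgs23-III-p030-x2.png`
… `-p032-x2.png`.  Row **B3.Eq3.25-3.32** of `HOME/lit-balaban-r15/ROWS-B3.md` (fold owner r15): toolkit file 2 of the p39 gen-8
target (p. 442, the sentence after (3.30), *"where the coefficient at the vertex [Π_{μμ′ν}] is bounded, and the coefficient at the
vertex [Π_{μμ′}] is proportional to (L^{j₀}η)^{−d+2}"*, at the zero-field torus instance).  The paper evaluates the pure-`C^ξ`
self-energy functions on the INFINITE lattice ((3.27)–(3.28) by momentum integrals, (3.29) by the Ward–Takahashi identity with the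
non-periodic test function λ of p. 442); on the finite torus of the model the same functions are these infinite-lattice values
plus period-shifted copies — this file is the exact bookkeeping of that statement, with no estimate.
WHAT IS PROVED (`N = P.sitesPerDir j`; `liftZ y x′` = p03's minimal representative of `y − x′`; `cosetPt N z n = z + N·n`):
* §1 periodizations on ℤ^d: congruence invariance `tsum_cosetPt_congr`, the reflected coset `tsum_cosetPt_neg` (`Σ_m f(−z + N·m) =
  Σ_k f(N·k − (z + N·n₀))`), `cosetPt_zero`.
* §2 the torus kernels of (3.26) for `C^ξ_T` as periodizations at `liftZ`: `CxiT_eq_tsum`, **`dAdjKernel_CxiT_eq_tsum`**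
  (`(C^ξ_T∂^{ξ*}_μ)(y,x′) = Σ'_n (∂^{ξ*}_μC^ξ)(liftZ y x′ + N·n)`), **`d2Kernel_CxiT_eq_tsum`** (`(∂^ξ_{μ′}C^ξ_T∂^{ξ*}_μ)(x′,y) =
  Σ'_n (∂^ξ_{μ′}∂^{ξ*}_μC^ξ)(liftZ x′ y + N·n)`), with r15's `pdiffAdjZ`/`pdiffZ` on `ZSite`.
* §3 **`sum_tsum_cosetPt_mul_eq`** — THE UNFOLDING IDENTITY: for `f, g : ℤ^d → ℝ` and a weight `ρ` on the torus,
  `Σ_{x′∈T} (Σ'_n f(liftZ y x′ + N·n))·(Σ'_m g(liftZ x′ y + N·m))·ρ(x′) = Σ'_{k∈ℤ^d} Σ'_{w∈ℤ^d} f(w)·g(N·k − w)·ρ(y − w̄)` (w̄ = w mod N),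
  under summability of the unfolded family (p03's bijection `cosetPt_liftZ_bijective`: T × ℤ^d ≅ ℤ^d); `summable_unfold_of_abs`
  reduces that hypothesis to `Σ_{w,k}|f(w)||g(N·k − w)| < ∞` and a bounded weight.
* §4 the torus displacement `x′_ν − y_ν` read back on ℤ^d: `liftZ_sub_cast_eq` (it is `valMinAbs(−w̄_ν)`), **`natAbs_liftZ_unfold_le`**
  (`|x′_ν − y_ν| ≤ |(N·k − w)_ν|` for EVERY `k` — minimality of the representative) and `liftZ_unfold_eq_neg` (it is `−w_ν` whenever
  `2|w_ν| < N`).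
Mathlib + the cited tree files only; theorems only, no definitions, no named facts; standard axioms.  Unit `lit-balaban-p39-g8`
(Phase-2 proof seat p39, gen 8), HOME `run/shared/lean/pub/lit-balaban/`, 2026-08-21.
-/

open scoped BigOperators

namespace Literature.MathematicalPhysics.QuantumFieldTheory.Balaban1983to89.B3TorusKernelUnfolding

open B3Sect3VectorSelfEnergy B3Sect3ScalarSelfEnergy B3CxiPropagator B3CxiTorusBound LatticeFieldCalculus

noncomputable section

/-! ## §1 Periodizations on ℤ^d -/

section Periodization

variable {d : ℕ}

/-- kernel: a periodization `Σ'_n f(z + N·n)` depends only on the residues of `z` mod `N` (any `f`; reindexing `n ↦ n + w`).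
[cite: Balaban1983Higgs3, (3.16) p.437] -/
theorem tsum_cosetPt_congr (N : ℕ) (f : ZSite d → ℝ) {z z' : ZSite d}
    (h : ∀ μ, ((z μ : ℤ) : ZMod N) = ((z' μ : ℤ) : ZMod N)) :
    ∑' n : ZSite d, f (cosetPt N z n) = ∑' n : ZSite d, f (cosetPt N z' n) := by
  have hw : ∀ μ, ∃ w : ℤ, z μ = z' μ + N * w := by
    intro μ
    obtain ⟨w, hw⟩ := (ZMod.intCast_eq_intCast_iff_dvd_sub (z' μ) (z μ) N).1 (h μ).symm
    exact ⟨w, by linarith⟩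
  choose w hw using hw
  have hz : z = z' + (N : ℤ) • (fun μ => w μ) := by
    funext μ; simp [hw μ]
  have hc : ∀ n, cosetPt N z n = cosetPt N z' ((fun μ => w μ) + n) := by
    intro n; rw [hz]; simp only [cosetPt, smul_add]; abel
  simp_rw [hc]
  exact (Equiv.addLeft (fun μ => w μ)).tsum_eq (fun n => f (cosetPt N z' n))

/-- kernel: the REFLECTED coset, re-centred at a point of the original one: `Σ'_m f(−z + N·m) = Σ'_k f(N·k − (z + N·n₀))`
(`m = k − n₀`). [cite: Balaban1983Higgs3, (3.27) p.441] -/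
theorem tsum_cosetPt_neg (N : ℕ) (f : ZSite d → ℝ) (z n₀ : ZSite d) :
    ∑' m : ZSite d, f (cosetPt N (-z) m) = ∑' k : ZSite d, f ((N : ℤ) • k - cosetPt N z n₀) := by
  rw [← (Equiv.addRight n₀).tsum_eq (fun k : ZSite d => f ((N : ℤ) • k - cosetPt N z n₀))]
  refine tsum_congr fun m => ?_
  simp only [Equiv.coe_addRight, cosetPt, smul_add]
  congr 1
  abel

/-- kernel: the coset of `0` is `N·ℤ^d`: `cosetPt N 0 k = N·k`. [cite: Balaban1983Higgs3, (3.16) p.437] -/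
theorem cosetPt_zero (N : ℕ) (k : ZSite d) : cosetPt N 0 k = (N : ℤ) • k := by
  simp [cosetPt]

/-- kernel: shifting the base point of a coset, `cosetPt N (z + s) n = cosetPt N z n + s`. [cite: Balaban1983Higgs3, (3.16) p.437] -/
theorem cosetPt_add (N : ℕ) (z s n : ZSite d) : cosetPt N (z + s) n = cosetPt N z n + s := by
  simp only [cosetPt]; abel

/-- kernel: `C^ξ` shifted along a coset is summable. [cite: Balaban1983Higgs3, (3.16) p.437] -/
theorem summable_Cxi_cosetPt_add {ξ : ℝ} (hξ : 0 < ξ) {N : ℕ} (hN : N ≠ 0) (z s : ZSite d) :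
    Summable fun n : ZSite d => Cxi d ξ (cosetPt N z n + s) := by
  have h := summable_coset (d := d) hξ hN (z + s)
  simpa only [cosetPt_add] using h

end Periodization

/-! ## §2 The torus kernels of (3.26) for `C^ξ_T` as periodizations -/

section TorusKernels

variable {P : Params} {j : ℕ}

/-- kernel: the representative of `y − (x′ + e_μ)` is `≡ (ỹ − x̃′) − e_μ`. [cite: Balaban1983Higgs3, (3.16) p.437] -/
theorem liftZ_shift_snd_cast (y x' : Site P j) (μ ν : Fin P.d) :
    ((liftZ y (x'.shift μ) ν : ℤ) : ZMod (P.sitesPerDir j)) =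
      (((liftZ y x' - unitVec μ) ν : ℤ) : ZMod (P.sitesPerDir j)) := by
  rw [liftZ_cast, Pi.sub_apply, Int.cast_sub, liftZ_cast, unitVec]
  by_cases h : ν = μ
  · subst h; simp [Site.shift]; ring
  · simp [Site.shift, Function.update_of_ne h, Pi.single_eq_of_ne h]

/-- kernel: `C^ξ_T(y, x′) = Σ'_n C^ξ(liftZ y x′ + N·n)` (p03's definition, unfolded). [cite: Balaban1983Higgs3, (3.16) p.437] -/
theorem CxiT_eq_tsum (ξ : ℝ) (y x' : Site P j) :
    CxiT ξ y x' = ∑' n : ZSite P.d, Cxi P.d ξ (cosetPt (P.sitesPerDir j) (liftZ y x') n) := rfl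

/-- kernel: `C^ξ_T(y, x′ + e_μ) = Σ'_n C^ξ(liftZ y x′ + N·n − e_μ)`. [cite: Balaban1983Higgs3, (3.16) p.437] -/
theorem CxiT_shift_snd_eq_tsum (ξ : ℝ) (y x' : Site P j) (μ : Fin P.d) :
    CxiT ξ y (x'.shift μ) = ∑' n : ZSite P.d, Cxi P.d ξ (cosetPt (P.sitesPerDir j) (liftZ y x') n - unitVec μ) := by
  rw [CxiT_eq_tsum, tsum_cosetPt_congr _ _ (liftZ_shift_snd_cast y x' μ)]
  refine tsum_congr fun n => ?_
  rw [sub_eq_add_neg (liftZ y x'), cosetPt_add, ← sub_eq_add_neg]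

/-- kernel: `C^ξ_T(x + e_μ, x′) = Σ'_n C^ξ(liftZ x x′ + N·n + e_μ)` (p03's `CxiT_shift`). [cite: Balaban1983Higgs3, (3.16) p.437] -/
theorem CxiT_shift_fst_eq_tsum (ξ : ℝ) (x x' : Site P j) (μ : Fin P.d) :
    CxiT ξ (x.shift μ) x' = ∑' n : ZSite P.d, Cxi P.d ξ (cosetPt (P.sitesPerDir j) (liftZ x x') n + unitVec μ) := by
  rw [CxiT_shift]
  unfold perCxi
  exact tsum_congr fun n => by rw [cosetPt_add]

/-- kernel: `C^ξ_T(x + e_{μ′}, x′ + e_μ) = Σ'_n C^ξ(liftZ x x′ + N·n + e_{μ′} − e_μ)`. [cite: Balaban1983Higgs3, (3.16) p.437] -/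
theorem CxiT_shift_shift_eq_tsum (ξ : ℝ) (x x' : Site P j) (μ' μ : Fin P.d) :
    CxiT ξ (x.shift μ') (x'.shift μ) =
      ∑' n : ZSite P.d, Cxi P.d ξ (cosetPt (P.sitesPerDir j) (liftZ x x') n + unitVec μ' - unitVec μ) := by
  have hc : ∀ ν, (((liftZ x (x'.shift μ) + unitVec μ') ν : ℤ) : ZMod (P.sitesPerDir j)) =
      (((liftZ x x' + (unitVec μ' - unitVec μ)) ν : ℤ) : ZMod (P.sitesPerDir j)) := by
    intro ν
    rw [Pi.add_apply, Int.cast_add, liftZ_shift_snd_cast, Pi.add_apply, Pi.sub_apply, Pi.sub_apply]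
    push_cast
    ring
  rw [CxiT_shift, perCxi_congr ξ hc]
  unfold perCxi
  exact tsum_congr fun n => by rw [cosetPt_add, add_sub_assoc]

/-- **`(C^ξ_T∂^{ξ*}_μ)(y, x′) = Σ'_n (∂^{ξ*}_μC^ξ)(liftZ y x′ + N·n)`** — the kernel `dAdjKernel ξ⁻¹ μ C^ξ_T` of (3.26) (r15's
`B3Sect3VectorSelfEnergy.dAdjKernel`: `ξ⁻¹(C^ξ_T(y, x′ + e_μ) − C^ξ_T(y, x′))`) IS the periodization of the ξℤ^d kernel
`∂^{ξ*}_μC^ξ = pdiffAdjZ ξ⁻¹ μ (Cxi d ξ)` (`ξ⁻¹(C^ξ(u − e_μ) − C^ξ(u))`). [cite: Balaban1983Higgs3, (3.26) p.440] -/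
theorem dAdjKernel_CxiT_eq_tsum {ξ : ℝ} (hξ : 0 < ξ) (μ : Fin P.d) (y x' : Site P j) :
    dAdjKernel ξ⁻¹ μ (CxiT ξ) y x' =
      ∑' n : ZSite P.d, pdiffAdjZ ξ⁻¹ μ (Cxi P.d ξ) (cosetPt (P.sitesPerDir j) (liftZ y x') n) := by
  have hN := P.sitesPerDir_ne_zero j
  have h1 : Summable fun n : ZSite P.d => Cxi P.d ξ (cosetPt (P.sitesPerDir j) (liftZ y x') n - unitVec μ) := by
    simpa only [sub_eq_add_neg] using summable_Cxi_cosetPt_add hξ hN (liftZ y x') (-unitVec μ)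
  have h2 : Summable fun n : ZSite P.d => Cxi P.d ξ (cosetPt (P.sitesPerDir j) (liftZ y x') n) :=
    summable_coset hξ hN _
  simp only [dAdjKernel, pdiffAdjZ]
  rw [CxiT_shift_snd_eq_tsum, CxiT_eq_tsum, ← h1.tsum_sub h2, ← tsum_mul_left]

/-- **`(∂^ξ_{μ′}C^ξ_T∂^{ξ*}_μ)(x, x′) = Σ'_n (∂^ξ_{μ′}∂^{ξ*}_μC^ξ)(liftZ x x′ + N·n)`** — the kernel `d2Kernel ξ⁻¹ μ′ μ C^ξ_T` of (3.26)
(`ξ⁻²[C^ξ_T(x+e_{μ′},x′+e_μ) − C^ξ_T(x+e_{μ′},x′) − C^ξ_T(x,x′+e_μ) + C^ξ_T(x,x′)]`) IS the periodization of the ξℤ^d kernel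
`∂^ξ_{μ′}∂^{ξ*}_μC^ξ = pdiffZ ξ⁻¹ μ′ (pdiffAdjZ ξ⁻¹ μ (Cxi d ξ))`. [cite: Balaban1983Higgs3, (3.26) p.440] -/
theorem d2Kernel_CxiT_eq_tsum {ξ : ℝ} (hξ : 0 < ξ) (μ' μ : Fin P.d) (x x' : Site P j) :
    d2Kernel ξ⁻¹ μ' μ (CxiT ξ) x x' =
      ∑' n : ZSite P.d, pdiffZ ξ⁻¹ μ' (pdiffAdjZ ξ⁻¹ μ (Cxi P.d ξ)) (cosetPt (P.sitesPerDir j) (liftZ x x') n) := by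
  have hN := P.sitesPerDir_ne_zero j
  set z := liftZ x x' with hz
  have sA : Summable fun n : ZSite P.d => Cxi P.d ξ (cosetPt (P.sitesPerDir j) z n + unitVec μ' - unitVec μ) := by
    simpa only [add_sub_assoc] using summable_Cxi_cosetPt_add hξ hN z (unitVec μ' - unitVec μ)
  have sB : Summable fun n : ZSite P.d => Cxi P.d ξ (cosetPt (P.sitesPerDir j) z n + unitVec μ') :=
    summable_Cxi_cosetPt_add hξ hN z (unitVec μ')
  have sC : Summable fun n : ZSite P.d => Cxi P.d ξ (cosetPt (P.sitesPerDir j) z n - unitVec μ) := by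
    simpa only [sub_eq_add_neg] using summable_Cxi_cosetPt_add hξ hN z (-unitVec μ)
  have sD : Summable fun n : ZSite P.d => Cxi P.d ξ (cosetPt (P.sitesPerDir j) z n) := summable_coset hξ hN _
  have hexp : ∀ n : ZSite P.d,
      pdiffZ ξ⁻¹ μ' (pdiffAdjZ ξ⁻¹ μ (Cxi P.d ξ)) (cosetPt (P.sitesPerDir j) z n) =
        ξ⁻¹ ^ 2 * ((Cxi P.d ξ (cosetPt (P.sitesPerDir j) z n + unitVec μ' - unitVec μ) -
          Cxi P.d ξ (cosetPt (P.sitesPerDir j) z n + unitVec μ')) -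
          (Cxi P.d ξ (cosetPt (P.sitesPerDir j) z n - unitVec μ) - Cxi P.d ξ (cosetPt (P.sitesPerDir j) z n))) := by
    intro n
    simp only [pdiffZ, pdiffAdjZ]
    ring
  rw [tsum_congr hexp, tsum_mul_left, (sA.sub sB).tsum_sub (sC.sub sD), sA.tsum_sub sB, sC.tsum_sub sD,
    ← CxiT_shift_shift_eq_tsum, ← CxiT_shift_fst_eq_tsum, ← CxiT_shift_snd_eq_tsum, ← CxiT_eq_tsum]
  simp only [d2Kernel]
  ring

/-- kernel: on the diagonal the base point is `0`: `liftZ y y = 0`. [cite: Balaban1983Higgs3, (3.16) p.437] -/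
theorem liftZ_self (y : Site P j) : liftZ y y = 0 := (liftZ_eq_zero_iff y y).2 rfl

/-- kernel: the LOCAL terms of (3.26) on the torus: `C^ξ_T(y, y) = Σ'_k C^ξ(N·k)`. [cite: Balaban1983Higgs3, (3.26) p.440] -/
theorem CxiT_diag_eq_tsum (ξ : ℝ) (y : Site P j) :
    CxiT ξ y y = ∑' k : ZSite P.d, Cxi P.d ξ ((P.sitesPerDir j : ℤ) • k) := by
  rw [CxiT_eq_tsum, liftZ_self]
  exact tsum_congr fun k => by rw [cosetPt_zero]

/-- kernel: the LOCAL terms of (3.26) on the torus: `(C^ξ_T∂^{ξ*}_μ)(y, y) = Σ'_k (∂^{ξ*}_μC^ξ)(N·k)`. [cite: Balaban1983Higgs3, (3.26) p.440] -/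
theorem dAdjKernel_CxiT_diag_eq_tsum {ξ : ℝ} (hξ : 0 < ξ) (μ : Fin P.d) (y : Site P j) :
    dAdjKernel ξ⁻¹ μ (CxiT ξ) y y = ∑' k : ZSite P.d, pdiffAdjZ ξ⁻¹ μ (Cxi P.d ξ) ((P.sitesPerDir j : ℤ) • k) := by
  rw [dAdjKernel_CxiT_eq_tsum hξ, liftZ_self]
  exact tsum_congr fun k => by rw [cosetPt_zero]

end TorusKernels

/-! ## §3 The unfolding identity -/

section Unfolding

variable {P : Params} {j : ℕ}

/-- kernel: the torus point `y − w̄` recovered from an unfolded site: for `w = liftZ y x′ + N·n` it is `x′`.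
[cite: Balaban1983Higgs3, (3.27) p.441] -/
theorem unfoldPt_cosetPt (y x' : Site P j) (n : ZSite P.d) :
    (fun μ => y μ - (((cosetPt (P.sitesPerDir j) (liftZ y x') n) μ : ℤ) : ZMod (P.sitesPerDir j))) = x' := by
  funext μ
  simp only [cosetPt_apply, Int.cast_add, Int.cast_mul, Int.cast_natCast, ZMod.natCast_self, zero_mul, add_zero,
    liftZ_cast, sub_sub_cancel]

/-- **THE UNFOLDING IDENTITY.**  For `f, g : ℤ^d → ℝ` and a weight `ρ` on the torus `T = Site P j` (`N` sites per direction),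
`Σ_{x′∈T} (Σ'_n f(liftZ y x′ + N·n))·(Σ'_m g(liftZ x′ y + N·m))·ρ(x′) = Σ'_{k∈ℤ^d} Σ'_{w∈ℤ^d} f(w)·g(N·k − w)·ρ(y − w̄)`
(`w̄ = w mod N`; the torus point `y − w̄` is the `x′` of the residue class of `w`), provided the unfolded family is summable.  The
torus `x′`-sum of a product of two periodized kernels — the two-propagator graphs of (3.26)/(3.27) with `C^ξ_T` — is the sum
over the period shifts `k` of the corresponding infinite-lattice expressions; `k = 0` is the ξℤ^d expression of pp. 441–442.
Route: p03's bijection `T × ℤ^d ≅ ℤ^d`, `(x′, n) ↦ liftZ y x′ + N·n` (`cosetPt_liftZ_bijective`), the congruence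
`liftZ x′ y ≡ −liftZ y x′`, re-centring `m = k − n`, and Fubini for the summable double family. [cite: Balaban1983Higgs3, (3.27) p.441] -/
theorem sum_tsum_cosetPt_mul_eq (y : Site P j) (f g : ZSite P.d → ℝ) (ρ : Site P j → ℝ)
    (hS : Summable fun p : ZSite P.d × ZSite P.d =>
      f p.1 * g ((P.sitesPerDir j : ℤ) • p.2 - p.1) * ρ (fun μ => y μ - ((p.1 μ : ℤ) : ZMod (P.sitesPerDir j)))) :
    ∑ x' : Site P j, (∑' n : ZSite P.d, f (cosetPt (P.sitesPerDir j) (liftZ y x') n)) *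
        (∑' m : ZSite P.d, g (cosetPt (P.sitesPerDir j) (liftZ x' y) m)) * ρ x' =
      ∑' k : ZSite P.d, ∑' w : ZSite P.d,
        f w * g ((P.sitesPerDir j : ℤ) • k - w) * ρ (fun μ => y μ - ((w μ : ℤ) : ZMod (P.sitesPerDir j))) := by
  set N := P.sitesPerDir j with hN
  set Φ : ZSite P.d → ZSite P.d → ℝ := fun w k =>
    f w * g ((N : ℤ) • k - w) * ρ (fun μ => y μ - ((w μ : ℤ) : ZMod N)) with hΦ
  have hSu : Summable (Function.uncurry Φ) := hS
  set H : ZSite P.d → ℝ := fun w => ∑' k, Φ w k with hH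
  have hHs : Summable H := hSu.prod
  -- each torus term is a coset sum of H
  have hterm : ∀ x' : Site P j,
      (∑' n, f (cosetPt N (liftZ y x') n)) * (∑' m, g (cosetPt N (liftZ x' y) m)) * ρ x' =
        ∑' n, H (cosetPt N (liftZ y x') n) := by
    intro x'
    have hg : ∀ n, ∑' m, g (cosetPt N (liftZ x' y) m) = ∑' k, g ((N : ℤ) • k - cosetPt N (liftZ y x') n) := by
      intro n
      rw [tsum_cosetPt_congr N g (fun μ => liftZ_swap_cast y x' μ)]
      exact tsum_cosetPt_neg N g (liftZ y x') n
    rw [← tsum_mul_right, ← tsum_mul_right]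
    refine tsum_congr fun n => ?_
    rw [hH]
    dsimp only
    rw [hΦ]
    dsimp only
    rw [unfoldPt_cosetPt, tsum_mul_right, tsum_mul_left, hg n]
  -- the torus sum of the coset sums is the sum over ℤ^d
  have hbij := cosetPt_liftZ_bijective (P := P) (j := j) y
  set e : Site P j × ZSite P.d ≃ ZSite P.d := Equiv.ofBijective _ hbij with he
  have h3 : ∑ x' : Site P j, ∑' n, H (cosetPt N (liftZ y x') n) = ∑' w, H w := by
    have hHe : Summable (fun p : Site P j × ZSite P.d => H (e p)) := e.summable_iff.2 hHs
    calc ∑ x' : Site P j, ∑' n, H (cosetPt N (liftZ y x') n) = ∑ x' : Site P j, ∑' n, H (e (x', n)) := rfl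
      _ = ∑' (x' : Site P j) (n : ZSite P.d), H (e (x', n)) := (tsum_fintype _).symm
      _ = ∑' p : Site P j × ZSite P.d, H (e p) := hHe.tsum_prod.symm
      _ = ∑' w, H w := e.tsum_eq H
  rw [Finset.sum_congr rfl fun x' _ => hterm x', h3, hH]
  exact hSu.tsum_comm.symm

/-- kernel: the unfolding identity without weight (`ρ ≡ 1`): `Σ_{x′} (Σ'_n f(liftZ y x′ + N·n))(Σ'_m g(liftZ x′ y + N·m)) =
Σ'_k Σ'_w f(w)g(N·k − w)`. [cite: Balaban1983Higgs3, (3.27) p.441] -/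
theorem sum_tsum_cosetPt_mul_eq_one (y : Site P j) (f g : ZSite P.d → ℝ)
    (hS : Summable fun p : ZSite P.d × ZSite P.d => f p.1 * g ((P.sitesPerDir j : ℤ) • p.2 - p.1)) :
    ∑ x' : Site P j, (∑' n : ZSite P.d, f (cosetPt (P.sitesPerDir j) (liftZ y x') n)) *
        (∑' m : ZSite P.d, g (cosetPt (P.sitesPerDir j) (liftZ x' y) m)) =
      ∑' k : ZSite P.d, ∑' w : ZSite P.d, f w * g ((P.sitesPerDir j : ℤ) • k - w) := by
  have h := sum_tsum_cosetPt_mul_eq y f g (fun _ => 1) (by simpa only [mul_one] using hS)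
  simpa only [mul_one] using h

/-- kernel: the summability hypothesis of the unfolding identity from ABSOLUTE summability of `Σ_{w,k}|f(w)||g(N·k − w)|` and a
bounded weight `|ρ| ≤ B`. [cite: Balaban1983Higgs3, (3.27) p.441] -/
theorem summable_unfold_of_abs (y : Site P j) (f g : ZSite P.d → ℝ) (ρ : Site P j → ℝ) {B : ℝ}
    (hρ : ∀ x', |ρ x'| ≤ B)
    (habs : Summable fun p : ZSite P.d × ZSite P.d => |f p.1| * |g ((P.sitesPerDir j : ℤ) • p.2 - p.1)|) :
    Summable fun p : ZSite P.d × ZSite P.d =>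
      f p.1 * g ((P.sitesPerDir j : ℤ) • p.2 - p.1) * ρ (fun μ => y μ - ((p.1 μ : ℤ) : ZMod (P.sitesPerDir j))) := by
  refine Summable.of_norm_bounded (habs.mul_right B) fun p => ?_
  rw [Real.norm_eq_abs, abs_mul, abs_mul]
  exact mul_le_mul_of_nonneg_left (hρ _) (mul_nonneg (abs_nonneg _) (abs_nonneg _))

end Unfolding

/-! ## §4 The torus displacement on the unfolded lattice -/

section Displacement

variable {P : Params} {j : ℕ}

/-- kernel: at the unfolded site `w` the torus coordinate difference `x′_ν − y_ν` (minimal representative, `x′ = y − w̄`) is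
`valMinAbs(−w̄_ν)`. [cite: Balaban1983Higgs3, (3.27) p.441] -/
theorem liftZ_unfold_apply (y : Site P j) (w : ZSite P.d) (ν : Fin P.d) :
    liftZ (fun μ => y μ - ((w μ : ℤ) : ZMod (P.sitesPerDir j))) y ν =
      (-(((w ν : ℤ)) : ZMod (P.sitesPerDir j))).valMinAbs := by
  simp [liftZ]

/-- **Minimality of the torus displacement**: for EVERY period shift `k`, `|x′_ν − y_ν| ≤ |(N·k − w)_ν|` at the unfolded site `w`
— the displacement factor `(x′_ν − x_ν)` of `Π_{μμ′ν}` (3.26)/(3.27) read on the torus is dominated by the ℤ^d coordinate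
difference to every period-shifted copy. [cite: Balaban1983Higgs3, (3.27) p.441] -/
theorem natAbs_liftZ_unfold_le (y : Site P j) (w k : ZSite P.d) (ν : Fin P.d) :
    (liftZ (fun μ => y μ - ((w μ : ℤ) : ZMod (P.sitesPerDir j))) y ν).natAbs ≤
      ((((P.sitesPerDir j : ℕ) : ℤ) • k - w) ν).natAbs := by
  rw [liftZ_unfold_apply]
  apply ZMod.natAbs_min_of_le_div_two (P.sitesPerDir j)
  · rw [ZMod.coe_valMinAbs, Pi.sub_apply, Pi.smul_apply, smul_eq_mul]
    push_cast
    rw [ZMod.natCast_self, zero_mul, zero_sub]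
  · exact ZMod.natAbs_valMinAbs_le _

/-- kernel: inside the fundamental domain the torus displacement IS the ℤ^d one: if `2|w_ν| < N` then `x′_ν − y_ν = −w_ν` at the
unfolded site `w`. [cite: Balaban1983Higgs3, (3.27) p.441] -/
theorem liftZ_unfold_eq_neg (y : Site P j) (w : ZSite P.d) (ν : Fin P.d) (hw : 2 * (w ν).natAbs < P.sitesPerDir j) :
    liftZ (fun μ => y μ - ((w μ : ℤ) : ZMod (P.sitesPerDir j))) y ν = -(w ν) := by
  rw [liftZ_unfold_apply, ZMod.valMinAbs_spec]
  refine ⟨by push_cast; ring, ?_, ?_⟩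
  · simp only [neg_mul]
    omega
  · simp only [neg_mul]
    omega

end Displacement

end

end Literature.MathematicalPhysics.QuantumFieldTheory.Balaban1983to89.B3TorusKernelUnfolding
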